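import Mathlib
import Literature.AlgebraicGeometry.Resolution.TranscendenceDefect
import Literature.AlgebraicGeometry.Resolution.AbhyankarInvariants
import Literature.AlgebraicGeometry.Resolution.PerronTransforms
import Literature.AlgebraicGeometry.Resolution.SubfieldTransport
import Literature.AlgebraicGeometry.Resolution.TranscendentallyImmediate
import HarnessLib

/-!
# Helpers for the ruled case over an Abhyankar base (`stub_ruledOverAbhyankarBaseShadows`), I

Crux `SemivaluationShadows` (item `stmt-ResolutionOfSingularities-16757`, route
`ResolutionOfSingularities/AbhyankarShadows`, the EXISTENCE half of Teissier's semivaluation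
conjecture typed over finite sets), line `birth`, registered stub
`stub_ruledOverAbhyankarBaseShadows` (`K = K₀(y)` ruled over an ABHYANKAR base `K₀`, value group
archimedean of any rational rank `r`). This file holds the rank bookkeeping of its proof
(`…RuledOverAbhyankarBaseShadowsTransfer.lean` holds the transfer,
`…RuledOverAbhyankarBaseShadows.lean` builds the data):

* `RuledAbh.latticeFrame` — a finitely generated ABHYANKAR valued function field
  (`transcendenceDefect = 0`) has a frame: non-zero `T₁, …, T_n` of values `< 1` whose values
  form a `ℤ`-basis of the value group (Temkin 2013, Rem. 2.1.3: the value group is a lattice;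
  tree `valueGroup_lattice_of_transcendenceDefect_eq_zero`, `exists_basis_lt_one_of_injective`).
* `RuledAbh.ratRank_comap_eq_of_torsion` — if the values of `K^×` are torsion over the values of
  an intermediate field `K₀`, then `ratRank (O ∩ K₀) = ratRank O`.
* `RuledAbh.archimedean_transport`, `RuledAbh.comap_comap_eq_comap`,
  `RuledAbh.transcendenceDefect_congr`, `RuledAbh.exists_algHom_lift`,
  `RuledAbh.exists_goodSubalgebra` (the subalgebra of BI-CONGRUENT elements) — transport lemmas.

No named facts beyond the tree's are used. [folklore]
-/

-- single-problem summit: the doubled namespace component `ResolutionOfSingularities` is forced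
set_option linter.dupNamespace false

noncomputable section

open Literature.AlgebraicGeometry.Resolution

namespace Summit.ResolutionOfSingularities.ResolutionOfSingularities.Theorems

namespace RuledAbh

/-! ## Congruences to constants modulo a maximal ideal -/

section Congruence

variable {k E Γ : Type*} [Field k] [Field E] [Algebra k E] [LinearOrderedCommGroupWithZero Γ]
  (v : Valuation E Γ)

/-- Sums of elements congruent to constants are congruent to the sum of the constants.
[folklore] -/
theorem cong_add {x x' : E} {c c' : k} (h : v (x - algebraMap k E c) < 1)
    (h' : v (x' - algebraMap k E c') < 1) : v (x + x' - algebraMap k E (c + c')) < 1 := by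
  rw [map_add, add_sub_add_comm]
  exact v.map_add_lt h h'

/-- Products of elements congruent to constants are congruent to the product of the constants
(constants having value `≤ 1`). [folklore] -/
theorem cong_mul (hk1 : ∀ c : k, v (algebraMap k E c) ≤ 1) {x x' : E} {c c' : k}
    (h : v (x - algebraMap k E c) < 1) (h' : v (x' - algebraMap k E c') < 1) :
    v (x * x' - algebraMap k E (c * c')) < 1 := by
  have hx : v x ≤ 1 := by
    have := v.map_add_le h.le (hk1 c)
    rwa [sub_add_cancel] at this
  have hrw : x * x' - algebraMap k E (c * c') =
      (x' - algebraMap k E c') * x + (x - algebraMap k E c) * algebraMap k E c' := by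
    rw [map_mul]; ring
  rw [hrw]
  refine v.map_add_lt ?_ ?_
  · rw [map_mul]; exact mul_lt_one_of_lt_of_le h' hx
  · rw [map_mul]; exact mul_lt_one_of_lt_of_le h (hk1 c')

/-- An element congruent to the constant `c` lies in the maximal ideal iff `c = 0` (non-zero
constants having value `1`). [folklore] -/
theorem lt_one_iff (hk1 : ∀ c : k, c ≠ 0 → v (algebraMap k E c) = 1) {x : E}
    {c : k} (h : v (x - algebraMap k E c) < 1) : v x < 1 ↔ c = 0 := by
  by_cases hc : c = 0
  · rw [hc, map_zero, sub_zero] at h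
    exact ⟨fun _ => hc, fun _ => h⟩
  · refine ⟨fun hx => absurd ?_ (lt_irrefl (1 : Γ)), fun h0 => absurd h0 hc⟩
    calc (1 : Γ) = v (algebraMap k E c) := (hk1 c hc).symm
      _ = v (x - (x - algebraMap k E c)) := by rw [sub_sub_cancel]
      _ < 1 := v.map_sub_lt hx h

end Congruence

/-! ## The value lattice of an Abhyankar function field has a frame -/

/-- **Frames of Abhyankar function fields.** For `K/k` finitely generated and `O ∋ k` a
valuation ring with `transcendenceDefect k O = 0`, the value group is a lattice (Temkin 2013,
Rem. 2.1.3, tree `valueGroup_lattice_of_transcendenceDefect_eq_zero`); a `ℤ`-basis of it of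
values `< 1` (Perron, tree `exists_basis_lt_one_of_injective`) lifts to non-zero
`T₁, …, T_n ∈ K` (`n` = the rank): every non-zero value is a monomial `∏ v(Tᵢ)^{mᵢ}`,
`m ∈ ℤⁿ`, and the `v(Tᵢ)` are `ℤ`-independent. [folklore] -/
theorem latticeFrame {k L : Type} [Field k] [Field L] [Algebra k L]
    (hfg : (⊤ : IntermediateField k L).FG) (O : ValuationSubring L)
    (hk : ∀ c : k, algebraMap k L c ∈ O) (hD : transcendenceDefect k O hk = 0) (n : ℕ)
    (hn : Module.finrank ℤ (Additive (O.ValueGroup)ˣ) = n) :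
    ∃ T : Fin n → L, (∀ i, T i ≠ 0) ∧ (∀ i, O.valuation (T i) < 1) ∧
      (∀ z : L, z ≠ 0 → ∃ m : Fin n → ℤ, O.valuation z = ∏ i, O.valuation (T i) ^ (m i)) ∧
      (∀ m : Fin n → ℤ, (∏ i, O.valuation (T i) ^ (m i)) = 1 → m = 0) := by
  classical
  subst hn
  obtain ⟨hfin, -, -⟩ := valueGroup_lattice_of_transcendenceDefect_eq_zero O hfg hk hD
  haveI : AddGroup.FG (Additive (O.ValueGroup)ˣ) := Module.Finite.iff_addGroup_fg.mp hfin
  obtain ⟨b, hb1, -, -⟩ := exists_basis_lt_one_of_injective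
    (AddMonoidHom.id (Additive (O.ValueGroup)ˣ)) (fun _ _ h => h) ∅ (by simp)
  -- lifts of the basis
  set u : Fin (Module.finrank ℤ (Additive (O.ValueGroup)ˣ)) → (O.ValueGroup)ˣ :=
    fun i => Additive.toMul (b i) with hu
  choose T hT using fun i => O.valuation_surjective ((u i : (O.ValueGroup)ˣ) : O.ValueGroup)
  have hprod : ∀ m : Fin _ → ℤ, (∏ i, O.valuation (T i) ^ (m i)) =
      (((∏ i, u i ^ (m i) : (O.ValueGroup)ˣ)) : O.ValueGroup) := fun m => by
    simp only [hT, Units.coe_prod, Units.val_zpow_eq_zpow_val]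
  have hsum : ∀ m : Fin _ → ℤ, Additive.ofMul (∏ i, u i ^ (m i)) = ∑ i, m i • b i := fun m => by
    simp only [ofMul_prod, ofMul_zpow, hu, ofMul_toMul]
  refine ⟨T, fun i h => ?_, fun i => ?_, fun z hz => ?_, fun m hm => ?_⟩
  · have h1 := hT i
    rw [h, map_zero] at h1
    exact (u i).ne_zero h1.symm
  · rw [hT, ← Units.val_one, Units.val_lt_val]
    simpa using hb1 i
  · set w : (O.ValueGroup)ˣ := Units.mk0 (O.valuation z) ((map_ne_zero _).mpr hz) with hw
    refine ⟨fun i => b.repr (Additive.ofMul w) i, ?_⟩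
    have h1 : Additive.ofMul (∏ i, u i ^ (b.repr (Additive.ofMul w) i)) = Additive.ofMul w := by
      rw [hsum, b.sum_repr]
    rw [hprod, Additive.ofMul.injective h1, hw, Units.val_mk0]
  · have h1 : (∏ i, u i ^ (m i)) = 1 := Units.ext (by rw [← hprod, hm, Units.val_one])
    have h2 : ∑ i, m i • b i = 0 := by rw [← hsum, h1, ofMul_one]
    funext i
    exact Fintype.linearIndependent_iff.mp b.linearIndependent m h2 i

/-! ## Rational rank through a torsion extension of value groups -/

/-- **Torsion cokernel does not change the rational rank.** If `K/k` is finitely generated,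
`O ∋ k` has rational rank `r` (`Module.finrank`, a natural number by Abhyankar's inequality) and
every value of `K^×` has a positive power which is the value of a non-zero element of the
intermediate field `K₀`, then `ratRank (O ∩ K₀) = r`: a maximal value-independent family of `K`
is pushed into `K₀` by taking the torsion witnesses. [folklore] -/
theorem ratRank_comap_eq_of_torsion {k K : Type} [Field k] [Field K] [Algebra k K]
    (hfg : (⊤ : IntermediateField k K).FG) (O : ValuationSubring K)
    (hk : ∀ c : k, algebraMap k K c ∈ O) (r : ℕ)
    (hrr : Module.finrank ℤ (Additive (O.ValueGroup)ˣ) = r) (K₀ : IntermediateField k K)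
    (htors : ∀ z : K, z ≠ 0 → ∃ N : ℕ, N ≠ 0 ∧ ∃ b : K, b ∈ K₀ ∧ b ≠ 0 ∧
      O.valuation z ^ N = O.valuation b) :
    ratRank (O.comap (algebraMap K₀ K)) = r := by
  classical
  have hlt : ratRank O < Cardinal.aleph0 := ratRank_lt_aleph0 O hk (trdeg_lt_aleph0_of_fg hfg)
  have hO : ratRank O = r := by
    rw [← hrr]
    exact (Cardinal.cast_toNat_of_lt_aleph0 hlt).symm
  obtain ⟨z, hz⟩ := exists_isValueIndependent_of_natCast_le_ratRank O (e := r) hO.ge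
  choose N hN b hbK hb0 hzb using fun j => htors (z j) (hz.1 j)
  refine ratRank_comap_eq_of_isValueIndependent O hO (fun j => (⟨b j, hbK j⟩ : K₀)) ?_
  refine ⟨fun j => hb0 j, fun S g hg j hj => ?_⟩
  have h1 : O.valuation (∏ j ∈ S, z j ^ ((N j : ℤ) * g j)) = 1 := by
    rw [map_prod] at hg ⊢
    rw [← hg]
    refine Finset.prod_congr rfl fun j _ => ?_
    rw [map_zpow₀, map_zpow₀, zpow_mul, zpow_natCast, hzb]
    rfl
  have h2 := hz.2 S (fun j => (N j : ℤ) * g j) h1 j hj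
  exact (mul_eq_zero.mp h2).resolve_left (by exact_mod_cast hN j)

/-! ## Transport lemmas -/

/-- Restricting an extension `V` of `O` along two commuting towers: `(V ∩ L) ∩ K₀ = O ∩ K₀`.
[folklore] -/
theorem comap_comap_eq_comap {K₀ K L M : Type*} [Field K₀] [Field K] [Field L] [Field M]
    [Algebra K₀ K] [Algebra K M] [Algebra K₀ M] [IsScalarTower K₀ K M] [Algebra K₀ L]
    [Algebra L M] [IsScalarTower K₀ L M] (V : ValuationSubring M) (O : ValuationSubring K)
    (hV : V.comap (algebraMap K M) = O) :
    (V.comap (algebraMap L M)).comap (algebraMap K₀ L) = O.comap (algebraMap K₀ K) := by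
  ext x
  rw [ValuationSubring.mem_comap, ValuationSubring.mem_comap, ValuationSubring.mem_comap, ← hV,
    ValuationSubring.mem_comap, ← IsScalarTower.algebraMap_apply, ← IsScalarTower.algebraMap_apply]

/-- The transcendence defect only depends on the valuation ring. [folklore] -/
theorem transcendenceDefect_congr {k K : Type*} [Field k] [Field K] [Algebra k K]
    {O O' : ValuationSubring K} (h : O = O') (hk : ∀ c : k, algebraMap k K c ∈ O)
    (hk' : ∀ c : k, algebraMap k K c ∈ O') :
    transcendenceDefect k O hk = transcendenceDefect k O' hk' := by
  subst h
  rfl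

/-- **Archimedean value groups are transported along exact realisations.** If `O = V ∩ K`,
`O_L = V ∩ L` inside a common valued field `(M, V)` and every non-zero value of `L` is the
value of an element of `K`, then the value group of `O_L` is archimedean as soon as that of
`O` is. [folklore] -/
theorem archimedean_transport {K L M : Type*} [Field K] [Field L] [Field M] (ιK : K →+* M)
    (ιL : L →+* M) (V : ValuationSubring M) (O : ValuationSubring K) (OL : ValuationSubring L)
    (hO : V.comap ιK = O) (hOL : V.comap ιL = OL)
    (hreal : ∀ z : L, z ≠ 0 → ∃ x : K, V.valuation (ιL z) = V.valuation (ιK x))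
    (hr1 : ∀ z w : K, O.valuation z < 1 → w ≠ 0 → ∃ N : ℕ, O.valuation z ^ N < O.valuation w) :
    ∀ z w : L, OL.valuation z < 1 → w ≠ 0 → ∃ N : ℕ, OL.valuation z ^ N < OL.valuation w := by
  intro z w hz hw
  by_cases hz0 : z = 0
  · refine ⟨1, ?_⟩
    rw [hz0, map_zero, pow_one]
    exact (Valuation.pos_iff _).mpr hw
  obtain ⟨x, hx⟩ := hreal z hz0
  obtain ⟨x', hx'⟩ := hreal w hw
  have heK := isEquiv_valuation_comap ιK hO
  have heL := isEquiv_valuation_comap ιL hOL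
  have hxlt : O.valuation x < 1 := by
    rw [← valuation_map_lt_one_iff ιK hO, ← hx, valuation_map_lt_one_iff ιL hOL]
    exact hz
  have hx'0 : x' ≠ 0 := by
    rintro rfl
    rw [map_zero, map_zero, map_eq_zero, map_eq_zero] at hx'
    exact hw hx'
  obtain ⟨N, hN⟩ := hr1 x x' hxlt hx'0
  refine ⟨N, ?_⟩
  rw [← map_pow] at hN ⊢
  have h1 : V.valuation (ιK (x ^ N)) < V.valuation (ιK x') := heK.lt_iff_lt.mpr hN
  rw [map_pow, map_pow, ← hx, ← hx', ← map_pow, ← map_pow] at h1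
  exact heL.lt_iff_lt.mp h1

/-- **Lifting a homomorphism through an injection.** If `g : L → M` is injective, compatible
with the constants, and `f : A → M` takes values in its range, then `f = g ∘ φ` for a
`k`-algebra map `φ : A → L`. [folklore] -/
theorem exists_algHom_lift {k A L M : Type*} [CommSemiring k] [Semiring A] [Algebra k A]
    [Semiring L] [Algebra k L] [Semiring M] [Algebra k M] (f : A →ₐ[k] M) (g : L →+* M)
    (hg : Function.Injective g) (hgk : ∀ c : k, g (algebraMap k L c) = algebraMap k M c)
    (h : ∀ a, ∃ v : L, g v = f a) : ∃ φ : A →ₐ[k] L, ∀ a, g (φ a) = f a := by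
  choose v hv using h
  refine ⟨{ toFun := v
            map_one' := hg (by rw [hv, map_one, map_one])
            map_mul' := fun a b => hg (by rw [hv, map_mul, map_mul, hv, hv])
            map_zero' := hg (by rw [hv, map_zero, map_zero])
            map_add' := fun a b => hg (by rw [hv, map_add, map_add, hv, hv])
            commutes' := fun c => hg (by rw [hv, hgk, AlgHom.commutes]) }, fun a => hv a⟩

/-- **The subalgebra of bi-congruent elements.** For valuations `v_K` on `K` and `v_M` on `M`
(constants of value `≤ 1`), a `k`-algebra `D` with maps `val : D → K`, `ψ : D → M`, a map
`g : L → M` compatible with constants and a `k`-subalgebra `R_L ⊆ L`: the elements `x = val w`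
of `K` such that `ψ w ∈ g(R_L)` and `x`, `ψ w` are congruent to ONE AND THE SAME constant
modulo the two maximal ideals form a `k`-subalgebra of `K`. [folklore] -/
theorem exists_goodSubalgebra {k K L M Dt : Type*} [Field k] [Field K] [Algebra k K] [Field L]
    [Algebra k L] [Field M] [Algebra k M] [CommRing Dt] [Algebra k Dt]
    {ΓK ΓM : Type*} [LinearOrderedCommGroupWithZero ΓK] [LinearOrderedCommGroupWithZero ΓM]
    (vK : Valuation K ΓK) (vM : Valuation M ΓM) (hk1 : ∀ c : k, vK (algebraMap k K c) ≤ 1)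
    (hk1' : ∀ c : k, vM (algebraMap k M c) ≤ 1) (val : Dt →ₐ[k] K) (ψ : Dt →ₐ[k] M)
    (g : L →+* M) (hgk : ∀ c : k, g (algebraMap k L c) = algebraMap k M c)
    (RL : Subalgebra k L) :
    ∃ A : Subalgebra k K, ∀ x : K, x ∈ A ↔ ∃ w : Dt, val w = x ∧ (∃ u ∈ RL, g u = ψ w) ∧
      ∃ a : k, vK (x - algebraMap k K a) < 1 ∧ vM (ψ w - algebraMap k M a) < 1 := by
  have hconst : ∀ a : k, ∃ w : Dt, val w = algebraMap k K a ∧ (∃ u ∈ RL, g u = ψ w) ∧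
      ∃ a' : k, vK (algebraMap k K a - algebraMap k K a') < 1 ∧
        vM (ψ w - algebraMap k M a') < 1 := fun a =>
    ⟨algebraMap k Dt a, val.commutes a, ⟨algebraMap k L a, RL.algebraMap_mem a,
      by rw [hgk, ψ.commutes]⟩, a, by rw [sub_self, map_zero]; exact zero_lt_one,
      by rw [ψ.commutes, sub_self, map_zero]; exact zero_lt_one⟩
  refine ⟨{ carrier := {x | ∃ w : Dt, val w = x ∧ (∃ u ∈ RL, g u = ψ w) ∧
              ∃ a : k, vK (x - algebraMap k K a) < 1 ∧ vM (ψ w - algebraMap k M a) < 1}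
            mul_mem' := ?_
            one_mem' := by simpa using hconst 1
            add_mem' := ?_
            zero_mem' := by simpa using hconst 0
            algebraMap_mem' := hconst }, fun _ => Iff.rfl⟩
  · rintro _ _ ⟨w, rfl, ⟨u, hu, hgu⟩, a, ha, ha'⟩ ⟨w', rfl, ⟨u', hu', hgu'⟩, a', hb, hb'⟩
    refine ⟨w * w', by rw [map_mul], ⟨u * u', RL.mul_mem hu hu',
      by rw [map_mul, map_mul, hgu, hgu']⟩, a * a', cong_mul vK hk1 ha hb, ?_⟩
    rw [map_mul]
    exact cong_mul vM hk1' ha' hb'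
  · rintro _ _ ⟨w, rfl, ⟨u, hu, hgu⟩, a, ha, ha'⟩ ⟨w', rfl, ⟨u', hu', hgu'⟩, a', hb, hb'⟩
    refine ⟨w + w', by rw [map_add], ⟨u + u', RL.add_mem hu hu',
      by rw [map_add, map_add, hgu, hgu']⟩, a + a', cong_add vK ha hb, ?_⟩
    rw [map_add]
    exact cong_add vM ha' hb'

end RuledAbh

end Summit.ResolutionOfSingularities.ResolutionOfSingularities.Theorems

end
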